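import Literature.NumberTheory.Sieve.HeathBrownCubicGrossenPNT
import Literature.NumberTheory.Sieve.HeathBrownCubicGrossenPrimeSums
import Literature.NumberTheory.Sieve.HeathBrownCubicUpperBoundTools
import HarnessLib

/-!
# Heath-Brown's Lemma 9.4 (Mitsui's PNT with Grössencharakteren) from the Siegel bound

The last analytic step towards `GrossenCharPNT A c C z₀` — the Lean shape of Lemma 9.4 of D. R.
Heath-Brown, *Primes represented by `x³ + 2y³`*, Acta Math. 186 (2001) (T. Mitsui, Jap. J. Math. 26
(1956), Lemma 5; Harman, *Prime-Detecting Sieves*, Lemma 13.19), fixed by `HeathBrownCubicGrossenPrimeSums`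
as the hypothesis consumed by the reduction *Lemma 9.2 ⇐ Lemma 9.4*: for `z ≥ z₀`, `1 ≤ q ≤ (log z)^A`,
`|j|, |k| ≤ exp(c√(log z))` and `ν^{(j,k)}` non-trivial `mod q`,
`‖θ_ν(z)‖ = ‖∑_{N(P) ≤ z} ν(P) log N(P)‖ ≤ C z exp(−c√(log z))`.

Main result: **`grossenCharPNT_of_realZero_bound`** — Lemma 9.4 holds for every `A > 0`, GIVEN Siegel's
bound for the real zeros of the real quadratic characters (`C(ε) q^{−ε} ≤ 1 − β` for every real zero
`β ∈ (17/18, 1]` of `L(s, χ)`, `χ² = χ₀ ≠ χ`, `χ(ε₀) = 1`; the case `β = 1` is `L(1, χ) ≠ 0`). This is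
exactly Heath-Brown's remark (p. 55): "quadratic characters are a potential problem, and Mitsui's
treatment employs the familiar arguments concerning Siegel zeros. In particular … the implied constant
in Lemma 9.4 is ineffective." The hypothesis is the output shape of `SiegelRealZerosAbstract.realZero_bound`
for the family of these characters; everything else is proved here and upstream:

* prime powers: `norm_sum_idealsUpTo_sub_grossenTheta_le` — `‖ψ_ν(x) − θ_ν(x)‖ ≤ 3√x(log x/log 2 + 1)log x`
  (`card_primesLE_le_three_mul`: at most `3y` prime ideals of norm `≤ y`; `exists_eq_prime_pow_of_not_isPrime`);
* ideal counting in `ℚ(∛2)` from the uniform sector counts: `exists_card_idealsUpTo_approx`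
  (`|#{0 < N(I) ≤ N} − V N| ≤ C N^{2/3}`), and `Λ_K` in short intervals (`sum_Ioc_vonMangoldtNorm_le`,
  `sum_Ioc_vonMangoldtNorm_le_of_count`);
* the core estimate `exists_norm_grossenTheta_le_core`: from the logarithmic Riesz mean bound
  `exists_logRieszMean_twistVonMangoldt_bound` (`HeathBrownCubicGrossenPNT`), removing the weight
  `log(x/n)` by differencing at `y = x(1 + e^{−(c/12)√(log x)})` (`PerronConductor.norm_sum_le_of_logRieszMean`),
  `‖θ_ν(z)‖ ≤ C (log Q+2)³ δ⁻¹ (log z)³ z exp(−(c/12)√(log z))` whenever `L(σ, ν) ≠ 0` for real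
  `σ > 1 − δ` (`δ ≤ 1/18`) and `max(log Q, 2c/δ) ≤ √(log z)`;
* the parameter choice (`grossenCharPNT_of_realZero_bound`): `δ = min(1/18, c₀/(log Q + log 4))` for
  `ν²` non-trivial (no zeros near `1` at all, `exists_zeroFree_grossenL`), `δ = min(1/18, C(ε)q^{−ε})`,
  `ε = 1/(4A)`, for the real quadratic `ν` (`params_of_isTrivialMod_sq`), `log Q ≤ 6 + 3A log log z + 2c√(log z)`
  (`log_condQZ_le`), powers of `log z` absorbed by `pow_le_mul_exp_sqrt`, largeness by `exists_large_of_le_sqrt`.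

Everything is PROVED; no definitions, no named facts.

## References

* D. R. Heath-Brown, *Primes represented by `x³ + 2y³`*, Acta Math. 186 (2001), Lemma 9.4 and p. 55.
  [cite: HeathBrownActa2001, Lemma 9.4]
* T. Mitsui, *Generalized prime number theorem*, Jap. J. Math. 26 (1956), 1–42, Lemma 5. [cite: Mitsui1956, Lemma 5]
* G. Harman, *Prime-Detecting Sieves*, LMS Monographs 33 (2007), Lemma 13.19. [cite: Harman2007, Lemma 13.19]
* H. L. Montgomery, R. C. Vaughan, *Multiplicative Number Theory I*, CUP 2007, §6.2 (Theorem 6.9), §11.3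
  (Theorem 11.16). [cite: MontgomeryVaughan2007, §11.3 Theorem 11.16]

## Mathlib / tree search

Tree: `HeathBrownCubicGrossenPrimeSums` (`primesLE`, `mem_primesLE`, `grossenTheta`, `GrossenCharPNT` — the
target shape), `HeathBrownCubicUpperBoundTools.card_filter_isPrime_absNorm_eq_le_three`, `HeathBrownCubicGrossenPNT`,
`HeathBrownCubicGrossenZFR`, `HeathBrownCubicGrossenLFunction` (`grossenL_ne_zero`, `params_of_isTrivialMod_sq`),
`HeathBrownCubicGrossenTrivial.isTrivialMod_iff`, `HeathBrownCubicGrossenSums` (`idealsUpTo`, `latticeGens`,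
`card_cong_eq`, `sum_idealsUpTo_eq`), `HeathBrownCubicTwistedCount.exists_uniform_sectorIoc_count`,
`TwistedDedekindCoefficients` (`idealVonMangoldt_*`, `eq_prime_pow_of_card_eq_one`, `vonMangoldtNorm_le`),
`PerronConductor.norm_sum_le_of_logRieszMean`. Mathlib: `Real.pow_div_factorial_le_exp`, `Real.log_le_rpow_div`,
`Real.le_log_one_add_of_nonneg`, `Finset.card_le_mul_card_image_of_maps_to`, `Finset.sum_filter_of_ne`.
-/

noncomputable section

namespace Literature.NumberTheory.Sieve.CubicSieve

open NumberField Finset Complex Set MeasureTheory Submodule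
open LFunctions LFunctions.NumberField LFunctions.PartialSumContinuation LFunctions.CubeRootTwoField CubicPrimes
open LFunctions.PerronConductor
open scoped Pointwise

section PsiTheta

/-- **At most `3y` non-zero prime ideals have norm `≤ y`** (norms lie in `{2,…,⌊y⌋}`, at most `3` primes
per norm). [folklore] -/
theorem card_primesLE_le_three_mul {y : ℝ} (hy : 0 ≤ y) : ((primesLE y).card : ℝ) ≤ 3 * y := by
  classical
  have hmap : ∀ P ∈ primesLE y, Ideal.absNorm P ∈ Finset.Icc 1 ⌊y⌋₊ := by
    intro P hP
    rw [mem_primesLE] at hP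
    rw [Finset.mem_Icc]
    refine ⟨Nat.one_le_iff_ne_zero.2 (Ideal.absNorm_eq_zero_iff.not.2 hP.2.1), Nat.le_floor hP.2.2⟩
  have hfib : ∀ n ∈ Finset.Icc 1 ⌊y⌋₊, ((primesLE y).filter fun P ↦ Ideal.absNorm P = n).card ≤ 3 := by
    intro n _
    have h := card_filter_isPrime_absNorm_eq_le_three (primesLE y) n
    refine le_trans (Finset.card_le_card ?_) h
    intro P hP
    rw [Finset.mem_filter] at hP ⊢
    have hP' := (mem_primesLE.1 hP.1)
    exact ⟨hP.1, hP'.1, hP'.2.1, hP.2⟩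
  have hcard := Finset.card_le_mul_card_image_of_maps_to (f := fun P ↦ Ideal.absNorm P) (s := primesLE y)
    (t := Finset.Icc 1 ⌊y⌋₊) hmap 3 hfib
  calc ((primesLE y).card : ℝ) ≤ ((3 * (Finset.Icc 1 ⌊y⌋₊).card : ℕ) : ℝ) := by exact_mod_cast hcard
    _ = 3 * (⌊y⌋₊ : ℝ) := by rw [Nat.card_Icc]; push_cast; ring
    _ ≤ 3 * y := by gcongr; exact Nat.floor_le hy

open scoped Classical in
/-- The primes among the non-zero ideals of norm `≤ ⌊x⌋` are `primesLE x` (`x ≥ 0`). [folklore] -/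
theorem filter_isPrime_idealsUpTo {x : ℝ} (hx : 0 ≤ x) :
    (idealsUpTo ⌊x⌋₊).filter (fun I ↦ I.IsPrime) = primesLE x := by
  ext P
  rw [Finset.mem_filter, mem_idealsUpTo, mem_primesLE, Nat.le_floor_iff hx]
  tauto

/-- `Λ(P) = log N(P)` for a non-zero prime ideal. [folklore] -/
theorem idealVonMangoldt_of_isPrime {P : Ideal (𝓞 K)} (hP : P.IsPrime) (hP0 : P ≠ ⊥) :
    idealVonMangoldt P = Real.log (Ideal.absNorm P) := by
  have h := idealVonMangoldt_prime_pow (Ideal.prime_of_isPrime hP0 hP) one_ne_zero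
  rwa [pow_one] at h

/-- A non-zero, non-prime ideal with `Λ(I) ≠ 0` is `P^m` with `P` prime and `m ≥ 2`; then
`N(P)² ≤ N(I)`, `2^m ≤ N(I)` and `Λ(I) = log N(P)`. [folklore] -/
theorem exists_eq_prime_pow_of_not_isPrime {I : Ideal (𝓞 K)} (hnp : ¬ I.IsPrime)
    (hΛ : idealVonMangoldt I ≠ 0) :
    ∃ (P : Ideal (𝓞 K)) (m : ℕ), P.IsPrime ∧ P ≠ ⊥ ∧ 2 ≤ m ∧ I = P ^ m ∧
      idealVonMangoldt I = Real.log (Ideal.absNorm P) ∧ Ideal.absNorm P ^ 2 ≤ Ideal.absNorm I ∧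
      2 ^ m ≤ Ideal.absNorm I := by
  classical
  have hcard : (UniqueFactorizationMonoid.normalizedFactors I).toFinset.card = 1 := by
    by_contra h; exact hΛ (idealVonMangoldt_eq_zero h)
  obtain ⟨P, hP, -, -, hm0, hIeq⟩ := eq_prime_pow_of_card_eq_one hcard
  set m := Multiset.card (UniqueFactorizationMonoid.normalizedFactors I) with hm
  have hPp : P.IsPrime := Ideal.isPrime_of_prime hP
  have hP0 : P ≠ ⊥ := hP.ne_zero
  have hm2 : 2 ≤ m := by
    by_contra hlt
    have hm1 : m = 1 := by omega
    rw [hm1, pow_one] at hIeq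
    exact hnp (hIeq ▸ hPp)
  have hNP : 2 ≤ Ideal.absNorm P := by
    have h1 : Ideal.absNorm P ≠ 0 := Ideal.absNorm_eq_zero_iff.not.2 hP0
    have h2 : Ideal.absNorm P ≠ 1 := by
      rw [Ne, Ideal.absNorm_eq_one_iff]; exact hPp.ne_top
    omega
  refine ⟨P, m, hPp, hP0, hm2, hIeq, ?_, ?_, ?_⟩
  · rw [hIeq]; exact idealVonMangoldt_prime_pow hP (by omega)
  · rw [hIeq, map_pow]; exact Nat.pow_le_pow_right (by omega) hm2
  · rw [hIeq, map_pow]; exact Nat.pow_le_pow_left hNP m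

/-- **`ψ_ν(x) − θ_ν(x)` is small**: for `|ν| ≤ 1` and `x ≥ 2`,
`‖∑_{0<N(I)≤x} ν(I)Λ(I) − θ_ν(x)‖ ≤ 3√x (log x/log 2 + 1) log x` (prime powers `P^m`, `m ≥ 2`).
[cite: MontgomeryVaughan2007, Theorem 2.7 (proof)] -/
theorem norm_sum_idealsUpTo_sub_grossenTheta_le {ν : Ideal (𝓞 K) → ℂ} (hν : ∀ I, ‖ν I‖ ≤ 1) {x : ℝ}
    (hx : 2 ≤ x) :
    ‖∑ I ∈ idealsUpTo ⌊x⌋₊, ν I * (idealVonMangoldt I : ℂ) - grossenTheta ν x‖ ≤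
      3 * Real.sqrt x * (Real.log x / Real.log 2 + 1) * Real.log x := by
  classical
  have hx0 : 0 ≤ x := by linarith
  have hx1 : 1 ≤ x := by linarith
  have hlogx : 0 ≤ Real.log x := Real.log_nonneg hx1
  have hlog2 : 0 < Real.log 2 := Real.log_pos one_lt_two
  -- split off the primes
  rw [← Finset.sum_filter_add_sum_filter_not (idealsUpTo ⌊x⌋₊) (fun I ↦ I.IsPrime),
    filter_isPrime_idealsUpTo hx0]
  have hθ : ∑ I ∈ primesLE x, ν I * (idealVonMangoldt I : ℂ) = grossenTheta ν x := by
    rw [grossenTheta]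
    refine Finset.sum_congr rfl fun P hP ↦ ?_
    rw [mem_primesLE] at hP
    rw [idealVonMangoldt_of_isPrime hP.1 hP.2.1]
  rw [hθ, add_sub_cancel_left]
  -- the prime powers with `m ≥ 2`: restrict to `Λ(I) ≠ 0`
  rw [← Finset.sum_filter_of_ne (s := (idealsUpTo ⌊x⌋₊).filter (fun I ↦ ¬ I.IsPrime))
    (p := fun I ↦ idealVonMangoldt I ≠ 0) (fun I _ hI h0 ↦ by rw [h0] at hI; simp at hI)]
  -- each term is at most `log x`, and there are at most `3√x (log x/log 2 + 1)` terms
  have hterm : ∀ I ∈ ((idealsUpTo ⌊x⌋₊).filter (fun I ↦ ¬ I.IsPrime)).filter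
      (fun I ↦ idealVonMangoldt I ≠ 0), ‖ν I * (idealVonMangoldt I : ℂ)‖ ≤ Real.log x := by
    intro I hI
    rw [Finset.mem_filter, Finset.mem_filter, mem_idealsUpTo] at hI
    obtain ⟨⟨⟨-, hIN⟩, hnp⟩, hΛ⟩ := hI
    obtain ⟨P, m, -, hP0, -, -, hΛeq, hN2, -⟩ := exists_eq_prime_pow_of_not_isPrime hnp hΛ
    rw [norm_mul, Complex.norm_real, Real.norm_of_nonneg (idealVonMangoldt_nonneg I), hΛeq]
    have hNP : (1 : ℝ) ≤ Ideal.absNorm P := by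
      have := Ideal.absNorm_eq_zero_iff.not.2 hP0
      exact_mod_cast Nat.one_le_iff_ne_zero.2 this
    have hNPx : (Ideal.absNorm P : ℝ) ≤ x := by
      have h1 : (Ideal.absNorm P : ℝ) ≤ (Ideal.absNorm P : ℝ) ^ 2 := by nlinarith
      have h2 : ((Ideal.absNorm P : ℝ)) ^ 2 ≤ Ideal.absNorm I := by exact_mod_cast hN2
      have h3 : (Ideal.absNorm I : ℝ) ≤ ⌊x⌋₊ := by exact_mod_cast hIN
      linarith [Nat.floor_le hx0]
    calc ‖ν I‖ * Real.log (Ideal.absNorm P) ≤ 1 * Real.log x := by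
          refine mul_le_mul (hν I) (Real.log_le_log (by linarith) hNPx) (Real.log_nonneg hNP) zero_le_one
      _ = Real.log x := one_mul _
  set T' := ((idealsUpTo ⌊x⌋₊).filter (fun I ↦ ¬ I.IsPrime)).filter (fun I ↦ idealVonMangoldt I ≠ 0)
    with hT'
  have hcardT' : (T'.card : ℝ) ≤ 3 * Real.sqrt x * (Real.log x / Real.log 2 + 1) := by
    -- `I ↦ P` (the radical) maps `T'` into `primesLE √x` with fibres of size `≤ log x/log 2 + 1`
    have hrad : ∀ I ∈ T', ∃ (P : Ideal (𝓞 K)) (m : ℕ), P ∈ primesLE (Real.sqrt x) ∧ 2 ≤ m ∧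
        (m : ℝ) ≤ Real.log x / Real.log 2 ∧ I = P ^ m := by
      intro I hI
      rw [hT', Finset.mem_filter, Finset.mem_filter, mem_idealsUpTo] at hI
      obtain ⟨⟨⟨-, hIN⟩, hnp⟩, hΛ⟩ := hI
      obtain ⟨P, m, hPp, hP0, hm2, hIeq, -, hN2, h2m⟩ := exists_eq_prime_pow_of_not_isPrime hnp hΛ
      have hNIx : (Ideal.absNorm I : ℝ) ≤ x := le_trans (by exact_mod_cast hIN) (Nat.floor_le hx0)
      refine ⟨P, m, ?_, hm2, ?_, hIeq⟩
      · rw [mem_primesLE]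
        refine ⟨hPp, hP0, ?_⟩
        rw [Real.le_sqrt (Nat.cast_nonneg _) hx0]
        calc ((Ideal.absNorm P : ℝ)) ^ 2 = ((Ideal.absNorm P ^ 2 : ℕ) : ℝ) := by push_cast; ring
          _ ≤ Ideal.absNorm I := by exact_mod_cast hN2
          _ ≤ x := hNIx
      · rw [le_div_iff₀ hlog2, ← Real.log_pow]
        refine Real.log_le_log (by positivity) ?_
        calc (2 : ℝ) ^ m = ((2 ^ m : ℕ) : ℝ) := by push_cast; ring
          _ ≤ Ideal.absNorm I := by exact_mod_cast h2m
          _ ≤ x := hNIx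
    -- `T'` lies in the image of `(P, m) ↦ P^m` on `primesLE √x × {2,…,M}`
    set Mx : ℕ := ⌊Real.log x / Real.log 2⌋₊ with hMx
    have hsub : T' ⊆ ((primesLE (Real.sqrt x)) ×ˢ (Finset.Icc 2 Mx)).image
        (fun pm : Ideal (𝓞 K) × ℕ ↦ pm.1 ^ pm.2) := by
      intro I hI
      obtain ⟨P, m, hP, hm2, hmle, hIeq⟩ := hrad I hI
      rw [Finset.mem_image]
      refine ⟨(P, m), Finset.mem_product.2 ⟨hP, Finset.mem_Icc.2 ⟨hm2, Nat.le_floor hmle⟩⟩, hIeq.symm⟩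
    have h1 : T'.card ≤ ((primesLE (Real.sqrt x)).card * (Finset.Icc 2 Mx).card) := by
      calc T'.card ≤ (((primesLE (Real.sqrt x)) ×ˢ (Finset.Icc 2 Mx)).image
            (fun pm : Ideal (𝓞 K) × ℕ ↦ pm.1 ^ pm.2)).card := Finset.card_le_card hsub
        _ ≤ ((primesLE (Real.sqrt x)) ×ˢ (Finset.Icc 2 Mx)).card := Finset.card_image_le
        _ = _ := Finset.card_product _ _
    have h2 : ((Finset.Icc 2 Mx).card : ℝ) ≤ Real.log x / Real.log 2 + 1 := by
      rw [Nat.card_Icc]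
      have : ((Mx + 1 - 2 : ℕ) : ℝ) ≤ Mx := by
        have : Mx + 1 - 2 ≤ Mx := by omega
        exact_mod_cast this
      refine this.trans ?_
      have hfl : (Mx : ℝ) ≤ Real.log x / Real.log 2 := Nat.floor_le (by positivity)
      linarith
    have h3 := card_primesLE_le_three_mul (Real.sqrt_nonneg x)
    calc (T'.card : ℝ) ≤ ((primesLE (Real.sqrt x)).card : ℝ) * ((Finset.Icc 2 Mx).card : ℝ) := by
          exact_mod_cast h1
      _ ≤ (3 * Real.sqrt x) * (Real.log x / Real.log 2 + 1) :=
          mul_le_mul h3 h2 (Nat.cast_nonneg _) (by positivity)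
      _ = 3 * Real.sqrt x * (Real.log x / Real.log 2 + 1) := by ring
  calc ‖∑ I ∈ T', ν I * (idealVonMangoldt I : ℂ)‖ ≤ ∑ I ∈ T', ‖ν I * (idealVonMangoldt I : ℂ)‖ := norm_sum_le _ _
    _ ≤ ∑ I ∈ T', Real.log x := Finset.sum_le_sum hterm
    _ = T'.card * Real.log x := by rw [Finset.sum_const, nsmul_eq_mul]
    _ ≤ 3 * Real.sqrt x * (Real.log x / Real.log 2 + 1) * Real.log x :=
        mul_le_mul_of_nonneg_right hcardT' hlogx

/-- **`ψ_ν` as the partial sums of `twistVonMangoldt`**: `∑_{n ≤ N} Λ_ν(n) = ∑_{0<N(I)≤N} ν(I)Λ(I)`.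
[folklore] -/
theorem sum_Icc_twistVonMangoldt_eq (ν : Ideal (𝓞 K) →*₀ ℂ) (N : ℕ) :
    ∑ n ∈ Finset.Icc 1 N, twistVonMangoldt K ν n = ∑ I ∈ idealsUpTo N, ν I * (idealVonMangoldt I : ℂ) := by
  rw [sum_idealsUpTo_eq]
  rfl

end PsiTheta

section IdealCount

/-- `#(idealsUpTo N) = #(latticeGens N^{1/3})` (canonical generators). [folklore] -/
theorem card_latticeGens_eq (t : ℝ) : (latticeGens t).card = (idealsUpTo ⌊t ^ 3⌋₊).card := by
  rw [latticeGens, Finset.card_image_of_injOn (injOn_coordVec_canonGen _)]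

/-- **Ideal counting in `ℚ(∛2)`**: `|#{I ≠ 0 : N(I) ≤ N} − V·N| ≤ C N^{2/3}` for `N ≥ 1`, with
`V = vol(F)/covol(𝓞_K)` (the residue of `ζ_K`, not identified here). [cite: Marcus2018, Ch. 6, Theorem 39] -/
theorem exists_card_idealsUpTo_approx :
    ∃ V C : ℝ, 0 ≤ V ∧ 0 ≤ C ∧ ∀ N : ℕ, 1 ≤ N →
      |((idealsUpTo N).card : ℝ) - V * N| ≤ C * (N : ℝ) ^ (2 / 3 : ℝ) := by
  obtain ⟨C₁, hC₁⟩ := exists_uniform_sectorIoc_count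
  set V : ℝ := volume.real (sector ((0 : ℝ), -Real.pi) (1, Real.pi)) /
    volume.real (ZSpan.fundamentalDomain basisW) with hV
  have hV0 : 0 ≤ V := div_nonneg measureReal_nonneg measureReal_nonneg
  refine ⟨V, max C₁ 0, hV0, le_max_right _ _, fun N hN ↦ ?_⟩
  have hN0 : (0 : ℝ) < N := by exact_mod_cast hN
  set t : ℝ := (N : ℝ) ^ ((1 : ℝ) / 3) with ht
  have ht1 : 1 ≤ t := Real.one_le_rpow (by exact_mod_cast hN) (by norm_num)
  have ht0 : 0 < t := by linarith
  have ht3 : t ^ 3 = N := by rw [ht, ← Real.rpow_natCast, ← Real.rpow_mul hN0.le]; norm_num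
  have ht2 : t ^ 2 = (N : ℝ) ^ (2 / 3 : ℝ) := by rw [ht, ← Real.rpow_natCast, ← Real.rpow_mul hN0.le]; norm_num
  have hfloor : ⌊t ^ 3⌋₊ = N := by rw [ht3, Nat.floor_natCast]
  -- `#idealsUpTo N = #latticeGens t = Nat.card of the lattice points in `t • F``
  have hbox : ((0 : ℝ), -Real.pi) ≤ ((1 : ℝ), Real.pi) := by
    rw [Prod.le_def]; exact ⟨zero_le_one, by linarith [Real.pi_pos]⟩
  have h := hC₁ ((0 : ℝ), -Real.pi) (1, Real.pi) le_rfl hbox le_rfl t ht1 ((-(1 : ℝ)) • embW (castVec 0))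
  have hcard : ((idealsUpTo N).card : ℝ) = Nat.card ↥(((fun w : ℝ × ℂ ↦ t • w + (-(1 : ℝ)) • embW (castVec 0)) ''
      sectorIoc ((0 : ℝ), -Real.pi) (1, Real.pi)) ∩ (span ℤ (Set.range basisW) : Set (ℝ × ℂ))) := by
    rw [← hfloor, ← card_latticeGens_eq, ← Nat.card_eq_finsetCard]
    have h1 := card_cong_eq 1 one_pos 0 t (sectorIoc ((0 : ℝ), -Real.pi) (1, Real.pi))
    simp only [Nat.cast_one, div_one] at h1
    rw [← h1]
    congr 1
    exact Nat.card_congr (Equiv.subtypeEquivRight fun v ↦ by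
      rw [mem_latticeGens_iff ht0]
      exact ⟨fun hv ↦ ⟨⟨one_dvd _, one_dvd _, one_dvd _⟩, hv⟩, fun hv ↦ hv.2⟩)
  rw [hcard, ← ht2, ← ht3]
  refine h.trans ?_
  gcongr
  exact le_max_left _ _

/-- **`#(idealsUpTo N)` as the partial sum of the ideal counts.** [folklore] -/
theorem card_idealsUpTo_eq (N : ℕ) : (idealsUpTo N).card = ∑ n ∈ Finset.Icc 1 N, idealNormCount K n := by
  rw [idealsUpTo, Finset.card_biUnion]
  · exact Finset.sum_congr rfl fun n _ ↦ card_idealsOfNorm K n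
  · intro m _ n _ hmn
    simp only [Function.onFun]
    rw [Finset.disjoint_left]
    intro I h1 h2
    rw [mem_idealsOfNorm] at h1 h2
    exact hmn (h1.symm.trans h2)

/-- **`Λ_K` in a short interval**: `∑_{M < n ≤ N} Λ_K(n) ≤ (#idealsUpTo N − #idealsUpTo M) · log N`
(`M ≤ N`). [folklore] -/
theorem sum_Ioc_vonMangoldtNorm_le {M N : ℕ} (hMN : M ≤ N) :
    ∑ n ∈ Finset.Ioc M N, vonMangoldtNorm K n ≤
      (((idealsUpTo N).card : ℝ) - (idealsUpTo M).card) * Real.log N := by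
  have hsplit : ((idealsUpTo N).card : ℝ) - (idealsUpTo M).card = ∑ n ∈ Finset.Ioc M N, (idealNormCount K n : ℝ) := by
    rw [card_idealsUpTo_eq, card_idealsUpTo_eq, Nat.cast_sum, Nat.cast_sum]
    have : Finset.Icc 1 N = Finset.Icc 1 M ∪ Finset.Ioc M N := by
      ext n; simp only [Finset.mem_union, Finset.mem_Icc, Finset.mem_Ioc]; omega
    rw [this, Finset.sum_union]
    · ring
    · rw [Finset.disjoint_left]; intro n h1 h2
      simp only [Finset.mem_Icc, Finset.mem_Ioc] at h1 h2; omega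
  rw [hsplit, Finset.sum_mul]
  refine Finset.sum_le_sum fun n hn ↦ ?_
  rw [Finset.mem_Ioc] at hn
  refine (vonMangoldtNorm_le n).trans ?_
  have hn0 : 0 < n := by omega
  exact mul_le_mul_of_nonneg_left (Real.log_le_log (by exact_mod_cast hn0) (by exact_mod_cast hn.2))
    (Nat.cast_nonneg _)

end IdealCount

section Core

variable {q : ℕ}

/-- `Ioc 0 N = Icc 1 N` in `ℕ`. [folklore] -/
theorem Ioc_zero_eq_Icc_one (N : ℕ) : Finset.Ioc 0 N = Finset.Icc 1 N := by
  ext n; simp only [Finset.mem_Ioc, Finset.mem_Icc]; omega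

/-- `log(1 + h) ≥ 2h/3` for `0 ≤ h ≤ 1`. [folklore] -/
theorem two_thirds_mul_le_log_one_add {h : ℝ} (h0 : 0 ≤ h) (h1 : h ≤ 1) : 2 * h / 3 ≤ Real.log (1 + h) := by
  refine le_trans ?_ (Real.le_log_one_add_of_nonneg h0)
  rw [div_le_div_iff₀ (by norm_num) (by linarith)]
  nlinarith

/-- `z^a ≤ z·exp(−κ√(log z))` when `κ√(log z) ≤ (1 − a) log z` (`z ≥ 1`). [folklore] -/
theorem rpow_le_mul_exp_neg {z a κ : ℝ} (hz : 1 ≤ z) (h : κ * Real.sqrt (Real.log z) ≤ (1 - a) * Real.log z) :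
    z ^ a ≤ z * Real.exp (-(κ * Real.sqrt (Real.log z))) := by
  have hz0 : 0 < z := by linarith
  rw [Real.rpow_def_of_pos hz0, ← Real.exp_log hz0, Real.log_exp, ← Real.exp_add]
  exact Real.exp_le_exp.2 (by nlinarith)

/-- **Ideals in a short norm interval**: with an ideal count `|#idealsUpTo N − V N| ≤ C₂ N^{2/3}`,
for `1 ≤ z ≤ y ≤ min(2z, z(1+h))`: `#idealsUpTo ⌊y⌋ − #idealsUpTo ⌊z⌋ ≤ V h z + V + 8 C₂ z^{2/3}`. [folklore] -/
theorem card_idealsUpTo_sub_le {V C₂ : ℝ} (hV : 0 ≤ V) (hC₂ : 0 ≤ C₂)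
    (hcount : ∀ N : ℕ, 1 ≤ N → |((idealsUpTo N).card : ℝ) - V * N| ≤ C₂ * (N : ℝ) ^ (2 / 3 : ℝ))
    {z y h : ℝ} (hz1 : 1 ≤ z) (hzy : z ≤ y) (hy2 : y ≤ 2 * z) (hyh : y ≤ z * (1 + h)) :
    ((idealsUpTo ⌊y⌋₊).card : ℝ) - (idealsUpTo ⌊z⌋₊).card ≤ V * h * z + V + 8 * C₂ * z ^ (2 / 3 : ℝ) := by
  have hz0 : 0 < z := by linarith
  have hfz1 : 1 ≤ ⌊z⌋₊ := Nat.le_floor (by exact_mod_cast hz1)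
  have hfy1 : 1 ≤ ⌊y⌋₊ := hfz1.trans (Nat.floor_le_floor hzy)
  have hcy := (abs_le.1 (hcount ⌊y⌋₊ hfy1)).2
  have hcz := (abs_le.1 (hcount ⌊z⌋₊ hfz1)).1
  have hfy : (⌊y⌋₊ : ℝ) ≤ y := Nat.floor_le (by linarith)
  have hfz : z - 1 ≤ (⌊z⌋₊ : ℝ) := by have := Nat.lt_floor_add_one z; linarith
  set A := (⌊y⌋₊ : ℝ) ^ (2 / 3 : ℝ) with hA
  set B := (⌊z⌋₊ : ℝ) ^ (2 / 3 : ℝ) with hB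
  set Z := z ^ (2 / 3 : ℝ) with hZ
  have h2z : (2 * z) ^ (2 / 3 : ℝ) ≤ 4 * Z := by
    rw [hZ, Real.mul_rpow (by norm_num) hz0.le]
    have : (2 : ℝ) ^ (2 / 3 : ℝ) ≤ 4 := by
      calc (2 : ℝ) ^ (2 / 3 : ℝ) ≤ 2 ^ (2 : ℝ) := Real.rpow_le_rpow_of_exponent_le one_le_two (by norm_num)
        _ = 4 := by rw [Real.rpow_two]; norm_num
    exact mul_le_mul_of_nonneg_right this (by positivity)
  have h23y : A ≤ 4 * Z :=
    (Real.rpow_le_rpow (Nat.cast_nonneg _) (hfy.trans hy2) (by norm_num)).trans h2z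
  have h23z : B ≤ 4 * Z :=
    (Real.rpow_le_rpow (Nat.cast_nonneg _) (by linarith [Nat.floor_le hz0.le]) (by norm_num)).trans h2z
  have hyz : (⌊y⌋₊ : ℝ) - ⌊z⌋₊ ≤ h * z + 1 := by linarith
  have e1 : V * ((⌊y⌋₊ : ℝ) - ⌊z⌋₊) ≤ V * (h * z + 1) := mul_le_mul_of_nonneg_left hyz hV
  have e2 : C₂ * A ≤ C₂ * (4 * Z) := mul_le_mul_of_nonneg_left h23y hC₂
  have e3 : C₂ * B ≤ C₂ * (4 * Z) := mul_le_mul_of_nonneg_left h23z hC₂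
  linarith

/-- `#idealsUpTo` is monotone. [folklore] -/
theorem card_idealsUpTo_mono {M N : ℕ} (h : M ≤ N) : (idealsUpTo M).card ≤ (idealsUpTo N).card :=
  Finset.card_le_card fun I hI ↦ by rw [mem_idealsUpTo] at hI ⊢; exact ⟨hI.1, hI.2.trans h⟩

/-- **`Λ_K` over `(z, y]`, `y = z(1+h) ≤ 2z`**: `∑_{z<n≤y} Λ_K(n) ≤ (V h z + V + 8C₂ z^{2/3}) · 2 log z`-type
bound (`log y ≤ 2L`). [folklore] -/
theorem sum_Ioc_vonMangoldtNorm_le_of_count {V C₂ : ℝ} (hV : 0 ≤ V) (hC₂ : 0 ≤ C₂)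
    (hcount : ∀ N : ℕ, 1 ≤ N → |((idealsUpTo N).card : ℝ) - V * N| ≤ C₂ * (N : ℝ) ^ (2 / 3 : ℝ))
    {z y h L : ℝ} (hz1 : 1 ≤ z) (hzy : z ≤ y) (hy2 : y ≤ 2 * z) (hh0 : 0 ≤ h) (hyh : y = z * (1 + h))
    (hlogy : Real.log y ≤ 2 * L) :
    ∑ n ∈ Finset.Ioc ⌊z⌋₊ ⌊y⌋₊, vonMangoldtNorm K n ≤ (V * h * z + V + 8 * C₂ * z ^ (2 / 3 : ℝ)) * (2 * L) := by
  have hz0 : 0 < z := by linarith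
  have hfloor : ⌊z⌋₊ ≤ ⌊y⌋₊ := Nat.floor_le_floor hzy
  have hfz1 : 1 ≤ ⌊z⌋₊ := Nat.le_floor (by exact_mod_cast hz1)
  have hfy1 : 1 ≤ ⌊y⌋₊ := hfz1.trans hfloor
  refine (sum_Ioc_vonMangoldtNorm_le hfloor).trans ?_
  have hdiff := card_idealsUpTo_sub_le hV hC₂ hcount hz1 hzy hy2 (le_of_eq hyh)
  have hfy : (⌊y⌋₊ : ℝ) ≤ y := Nat.floor_le (by linarith)
  have hfy1' : (1 : ℝ) ≤ ⌊y⌋₊ := by exact_mod_cast hfy1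
  have hlogfy : Real.log ⌊y⌋₊ ≤ 2 * L := (Real.log_le_log (by linarith) hfy).trans hlogy
  have hlogfy0 : 0 ≤ Real.log ⌊y⌋₊ := Real.log_nonneg hfy1'
  have hpos : 0 ≤ V * h * z + V + 8 * C₂ * z ^ (2 / 3 : ℝ) := by positivity
  exact mul_le_mul hdiff hlogfy hlogfy0 hpos

/-- **`‖ψ_ν(z) − θ_ν(z)‖ ≤ 9 √z (log z)²`** for `z ≥ e⁴`, `|ν| ≤ 1`. [folklore] -/
theorem norm_psi_sub_grossenTheta_le (ν : Ideal (𝓞 K) →*₀ ℂ) (hν1 : ∀ I, ‖ν I‖ ≤ 1) {z : ℝ}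
    (hz : Real.exp 4 ≤ z) :
    ‖∑ n ∈ Finset.Ioc 0 ⌊z⌋₊, twistVonMangoldt K ν n - grossenTheta ν z‖ ≤
      9 * Real.sqrt z * Real.log z ^ 2 := by
  have hz0 : 0 < z := (Real.exp_pos 4).trans_le hz
  have hz2 : 2 ≤ z := le_trans (by have := Real.add_one_le_exp (4 : ℝ); linarith) hz
  have hL4 : 4 ≤ Real.log z := by rw [Real.le_log_iff_exp_le hz0]; exact hz
  rw [Ioc_zero_eq_Icc_one, sum_Icc_twistVonMangoldt_eq]
  refine (norm_sum_idealsUpTo_sub_grossenTheta_le (ν := ν) hν1 hz2).trans ?_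
  have h2 : (1 : ℝ) / 2 < Real.log 2 := by have := Real.log_two_gt_d9; linarith
  have hl1 : Real.log z / Real.log 2 ≤ 2 * Real.log z := by
    rw [div_le_iff₀ (by linarith)]; nlinarith
  have hl2 : Real.log z / Real.log 2 + 1 ≤ 3 * Real.log z := by linarith
  have hs : 0 ≤ 3 * Real.sqrt z := by positivity
  calc 3 * Real.sqrt z * (Real.log z / Real.log 2 + 1) * Real.log z
      ≤ 3 * Real.sqrt z * (3 * Real.log z) * Real.log z := by
        refine mul_le_mul_of_nonneg_right (mul_le_mul_of_nonneg_left hl2 hs) (by linarith)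
    _ = 9 * Real.sqrt z * Real.log z ^ 2 := by ring

/-- The absorbing weight `W = z·exp(−(c/12)√L)` dominates `√z`, `z^{2/3}` and `1` when `36c ≤ √L`,
`L = log z ≥ 1`. [folklore] -/
theorem weight_dominates {z c L : ℝ} (hz1 : 1 ≤ z) (hL : L = Real.log z) (hL1 : 1 ≤ L)
    (hcs : 36 * c ≤ Real.sqrt L) :
    Real.sqrt z ≤ z * Real.exp (-(c / 12 * Real.sqrt L)) ∧
      z ^ (2 / 3 : ℝ) ≤ z * Real.exp (-(c / 12 * Real.sqrt L)) ∧
      1 ≤ z * Real.exp (-(c / 12 * Real.sqrt L)) := by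
  have hL0 : 0 < L := by linarith
  have hsqLL : Real.sqrt L * Real.sqrt L = L := Real.mul_self_sqrt hL0.le
  have hkey : c / 12 * Real.sqrt L ≤ L / 3 := by
    calc c / 12 * Real.sqrt L ≤ (Real.sqrt L / 36) / 12 * Real.sqrt L :=
          mul_le_mul_of_nonneg_right (by linarith) (Real.sqrt_nonneg L)
      _ = L / 432 := by rw [div_div, div_mul_eq_mul_div, hsqLL]; ring
      _ ≤ L / 3 := by linarith
  rw [hL] at hkey ⊢
  refine ⟨?_, ?_, ?_⟩
  · rw [Real.sqrt_eq_rpow]; exact rpow_le_mul_exp_neg hz1 (by linarith)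
  · exact rpow_le_mul_exp_neg hz1 (by linarith)
  · have h := rpow_le_mul_exp_neg (a := 0) (κ := c / 12) hz1 (by rw [hL] at hL1; linarith)
    rwa [Real.rpow_zero] at h

/-- The final bookkeeping of the core estimate (pure algebra): with `P ≥ 1`, `L ≥ 1`, `W ≥ 1` and
non-negative constants, `27/2·(C_T P)L²W + (VW + V + 8C₂W)(2L) + 9WL² ≤ (27/2 C_T + 4V + 16C₂ + 9) P L³ W`.
[folklore] -/
theorem core_algebra {C_T V C₂ P L W : ℝ} (hC_T : 0 ≤ C_T) (hV : 0 ≤ V) (hC₂ : 0 ≤ C₂) (hP1 : 1 ≤ P)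
    (hL1 : 1 ≤ L) (hW1 : 1 ≤ W) :
    27 / 2 * (C_T * P) * L ^ 2 * W + (V * W + V + 8 * C₂ * W) * (2 * L) + 9 * W * L ^ 2 ≤
      (27 / 2 * C_T + 4 * V + 16 * C₂ + 9) * P * L ^ 3 * W := by
  have hW0 : 0 ≤ W := by linarith
  have hL0 : 0 ≤ L := by linarith
  have hP0 : 0 ≤ P := by linarith
  set X : ℝ := L ^ 3 * W with hX
  have hX0 : 0 ≤ X := by positivity
  have hLW0 : 0 ≤ L * W := by positivity
  have a1 : L ^ 2 * W ≤ X := by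
    have : L ^ 2 * W * 1 ≤ L ^ 2 * W * L := mul_le_mul_of_nonneg_left hL1 (by positivity)
    nlinarith
  have a2 : L * W ≤ X := by
    have : L * W * 1 ≤ L * W * L := mul_le_mul_of_nonneg_left hL1 hLW0
    nlinarith
  have a4 : L ≤ X := by
    have : L * 1 ≤ L * W := mul_le_mul_of_nonneg_left hW1 hL0
    linarith
  have a5 : X ≤ P * X := by
    have : 1 * X ≤ P * X := mul_le_mul_of_nonneg_right hP1 hX0
    linarith
  have t1 : 27 / 2 * (C_T * P) * L ^ 2 * W ≤ 27 / 2 * C_T * (P * X) := by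
    have : C_T * P * (L ^ 2 * W) ≤ C_T * P * X := mul_le_mul_of_nonneg_left a1 (by positivity)
    nlinarith
  have t2 : (V * W + V + 8 * C₂ * W) * (2 * L) ≤ (4 * V + 16 * C₂) * (P * X) := by
    have e1 : V * (L * W) ≤ V * (P * X) := mul_le_mul_of_nonneg_left (a2.trans a5) hV
    have e2 : V * L ≤ V * (P * X) := mul_le_mul_of_nonneg_left (a4.trans a5) hV
    have e3 : C₂ * (L * W) ≤ C₂ * (P * X) := mul_le_mul_of_nonneg_left (a2.trans a5) hC₂
    nlinarith
  have t3 : 9 * W * L ^ 2 ≤ 9 * (P * X) := by nlinarith [a1.trans a5]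
  calc _ ≤ 27 / 2 * C_T * (P * X) + (4 * V + 16 * C₂) * (P * X) + 9 * (P * X) := add_le_add (add_le_add t1 t2) t3
    _ = (27 / 2 * C_T + 4 * V + 16 * C₂ + 9) * P * L ^ 3 * W := by rw [hX]; ring

/-- **The core estimate for `θ_ν(z)`** from the logarithmic Riesz mean: absolute `c > 0`, `C ≥ 0` with
`‖θ_ν(z)‖ ≤ C (log Q + 2)³ δ⁻¹ (log z)³ z exp(−(c/12)√(log z))` for every non-trivial `ν^{(j,k)} mod q`,
every `δ ∈ (0, 1/18]` with no real zero of `L(s, ν)` in `(1 − δ, ∞)`, and every `z ≥ e⁴` with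
`max(log Q, 2c/δ) ≤ √(log z)`. [cite: Mitsui1956, Lemma 5; HeathBrownActa2001, §9 Lemma 9.4] -/
theorem exists_norm_grossenTheta_le_core :
    ∃ c : ℝ, 0 < c ∧ ∃ C : ℝ, 0 ≤ C ∧ ∀ (q : ℕ) (hq : 1 ≤ q) (χ : MulChar (QuotMod q) ℂ) (j k : ℤ),
      ¬ IsTrivialMod q (grossenChar hq χ j k) → ∀ δ : ℝ, 0 < δ → δ ≤ 1 / 18 →
        (∀ β : ℝ, 1 - δ < β → grossenL hq χ j k β ≠ 0) →
        ∀ z : ℝ, Real.exp 4 ≤ z →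
          max (Real.log (condQZ q j k)) (2 * c / δ) ≤ Real.sqrt (Real.log z) →
          ‖grossenTheta (grossenChar hq χ j k) z‖ ≤
            C * ((Real.log (condQZ q j k) + 2) ^ 3 / δ) * Real.log z ^ 3 * z *
              Real.exp (-(c / 12 * Real.sqrt (Real.log z))) := by
  obtain ⟨c, hc, C_T, hC_T, hR⟩ := exists_logRieszMean_twistVonMangoldt_bound
  obtain ⟨V, C₂, hV, hC₂, hcount⟩ := exists_card_idealsUpTo_approx
  refine ⟨c, hc, 27 / 2 * C_T + 4 * V + 16 * C₂ + 9, by positivity,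
    fun q hq χ j k hν δ hδ hδ18 hnz z hz hmax ↦ ?_⟩
  set ν := grossenChar hq χ j k with hνdef
  have hν1 : ∀ I, ‖ν I‖ ≤ 1 := norm_grossenChar_le hq χ j k
  obtain ⟨Q, hQdef⟩ : ∃ Q : ℝ, Q = condQZ q j k := ⟨_, rfl⟩
  rw [← hQdef] at hmax ⊢
  have hQ1 : 1 ≤ Q := hQdef ▸ one_le_condQZ hq j k
  have hlogQ : 0 ≤ Real.log Q := Real.log_nonneg hQ1
  obtain ⟨L, hL⟩ : ∃ L : ℝ, L = Real.log z := ⟨_, rfl⟩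
  have hz0 : 0 < z := (Real.exp_pos 4).trans_le hz
  have hz1 : 1 ≤ z := le_trans (by have := Real.add_one_le_exp (4 : ℝ); linarith) hz
  have hL4 : 4 ≤ L := by rw [hL, Real.le_log_iff_exp_le hz0]; exact hz
  have hL1 : 1 ≤ L := by linarith
  have hL0 : 0 < L := by linarith
  have hsqL : 2 ≤ Real.sqrt L := by
    rw [show (2 : ℝ) = Real.sqrt 4 by rw [show (4 : ℝ) = 2 ^ 2 by norm_num, Real.sqrt_sq (by norm_num)]]
    exact Real.sqrt_le_sqrt hL4
  have hsqL1 : 1 ≤ Real.sqrt L := by linarith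
  have hsqLL : Real.sqrt L * Real.sqrt L = L := Real.mul_self_sqrt hL0.le
  -- `c ≤ √L/36` from the hypothesis
  have hcδ : 2 * c / δ ≤ Real.sqrt L := by rw [hL]; exact (le_max_right _ _).trans hmax
  have hcs : 36 * c ≤ Real.sqrt L := by
    have h1 : 2 * c ≤ δ * Real.sqrt L := by
      have := (div_le_iff₀ hδ).1 hcδ; linarith only [this, mul_comm δ (Real.sqrt L)]
    nlinarith only [h1, hδ18, hδ, Real.sqrt_nonneg L]
  -- the step `h` and the point `y = z(1+h)`
  obtain ⟨h, hh⟩ : ∃ h : ℝ, h = Real.exp (-(c / 12 * Real.sqrt L)) := ⟨_, rfl⟩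
  have hh0 : 0 < h := by rw [hh]; exact Real.exp_pos _
  have hh1 : h ≤ 1 := by
    rw [hh]; refine Real.exp_le_one_iff.2 ?_
    have : 0 ≤ c / 12 * Real.sqrt L := by positivity
    linarith only [this]
  obtain ⟨y, hy⟩ : ∃ y : ℝ, y = z * (1 + h) := ⟨_, rfl⟩
  have hzy : z < y := by rw [hy]; nlinarith only [hz0, hh0]
  have hy2 : y ≤ 2 * z := by rw [hy]; nlinarith only [hz0, hh1]
  have hy4 : Real.exp 4 ≤ y := hz.trans hzy.le
  have hlogy : Real.log y ≤ 2 * L := by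
    calc Real.log y ≤ Real.log (2 * z) := Real.log_le_log (by linarith) hy2
      _ = Real.log 2 + L := by rw [Real.log_mul (by norm_num) hz0.ne', hL]
      _ ≤ 2 * L := by
          have : Real.log 2 < 1 := by
            have := Real.log_two_lt_d9; linarith
          linarith
  have hlogy0 : 0 ≤ Real.log y := Real.log_nonneg (by linarith)
  have hsqLy : Real.sqrt L ≤ Real.sqrt (Real.log y) := by
    rw [hL]; exact Real.sqrt_le_sqrt (Real.log_le_log hz0 hzy.le)
  -- the two Riesz means
  obtain ⟨K₁, hK₁⟩ : ∃ K₁ : ℝ, K₁ = C_T * ((Real.log Q + 2) ^ 3 / δ) := ⟨_, rfl⟩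
  have hK₁0 : 0 ≤ K₁ := by rw [hK₁]; positivity
  have hmax' : max (Real.log (condQZ q j k)) (2 * c / δ) ≤ Real.sqrt (Real.log z) := by rwa [← hQdef]
  have hmaxL : max (Real.log (condQZ q j k)) (2 * c / δ) ≤ Real.sqrt L := by rwa [hL]
  have hRz := hR q hq χ j k hν δ hδ hδ18 hnz z hz hmax'
  have hRy := hR q hq χ j k hν δ hδ hδ18 hnz y hy4 (hmaxL.trans hsqLy)
  rw [← hQdef] at hRz hRy
  -- `E(y) ≤ E(z)`
  have hEy : Real.exp (-(c / 6 * Real.sqrt (Real.log y))) ≤ Real.exp (-(c / 6 * Real.sqrt L)) :=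
    Real.exp_le_exp.2 (by nlinarith only [hsqLy, hc.le])
  obtain ⟨E, hE⟩ : ∃ E : ℝ, E = Real.exp (-(c / 6 * Real.sqrt L)) := ⟨_, rfl⟩
  have hE0 : 0 < E := by rw [hE]; exact Real.exp_pos _
  rw [← hE] at hEy
  have hEh : E / h = Real.exp (-(c / 12 * Real.sqrt L)) := by
    rw [hE, hh, ← Real.exp_sub]; congr 1; ring
  have hRsum : ‖∑ n ∈ Finset.Ioc 0 ⌊y⌋₊, twistVonMangoldt K ν n * (Real.log (y / n) : ℂ)‖ +
      ‖∑ n ∈ Finset.Ioc 0 ⌊z⌋₊, twistVonMangoldt K ν n * (Real.log (z / n) : ℂ)‖ ≤ 9 * K₁ * L ^ 2 * z * E := by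
    have h1 : C_T * ((Real.log Q + 2) ^ 3 / δ) * Real.log y ^ 2 * y * Real.exp (-(c / 6 * Real.sqrt (Real.log y)))
        ≤ K₁ * (2 * L) ^ 2 * (2 * z) * E := by
      rw [hK₁]
      have hP0 : 0 ≤ C_T * ((Real.log Q + 2) ^ 3 / δ) := by positivity
      have hA : Real.log y ^ 2 * y * Real.exp (-(c / 6 * Real.sqrt (Real.log y))) ≤ (2 * L) ^ 2 * (2 * z) * E := by
        have e1 : Real.log y ^ 2 ≤ (2 * L) ^ 2 := pow_le_pow_left₀ hlogy0 hlogy 2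
        have e2 : 0 ≤ Real.exp (-(c / 6 * Real.sqrt (Real.log y))) := (Real.exp_pos _).le
        calc Real.log y ^ 2 * y * Real.exp (-(c / 6 * Real.sqrt (Real.log y)))
            ≤ (2 * L) ^ 2 * (2 * z) * Real.exp (-(c / 6 * Real.sqrt (Real.log y))) := by
              refine mul_le_mul_of_nonneg_right ?_ e2
              exact mul_le_mul e1 hy2 (by linarith) (by positivity)
          _ ≤ (2 * L) ^ 2 * (2 * z) * E := mul_le_mul_of_nonneg_left hEy (by positivity)
      calc _ = C_T * ((Real.log Q + 2) ^ 3 / δ) * (Real.log y ^ 2 * y * Real.exp (-(c / 6 * Real.sqrt (Real.log y)))) := by ring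
        _ ≤ C_T * ((Real.log Q + 2) ^ 3 / δ) * ((2 * L) ^ 2 * (2 * z) * E) := mul_le_mul_of_nonneg_left hA hP0
        _ = _ := by ring
    have h2 : C_T * ((Real.log Q + 2) ^ 3 / δ) * Real.log z ^ 2 * z * Real.exp (-(c / 6 * Real.sqrt (Real.log z)))
        = K₁ * L ^ 2 * z * E := by rw [hK₁, hE, hL]
    calc _ ≤ K₁ * (2 * L) ^ 2 * (2 * z) * E + K₁ * L ^ 2 * z * E := add_le_add (hRy.trans h1) (hRz.trans_eq h2)
      _ = 9 * K₁ * L ^ 2 * z * E := by ring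
  -- removing the logarithmic weight
  have hab : ∀ n, ‖twistVonMangoldt K ν n‖ ≤ vonMangoldtNorm K n := norm_twistVonMangoldt_le hν1
  have hremove := norm_sum_le_of_logRieszMean hab hz0 hzy
  have hlog1h : 2 * h / 3 ≤ Real.log (y / z) := by
    have : y / z = 1 + h := by rw [hy]; field_simp
    rw [this]; exact two_thirds_mul_le_log_one_add hh0.le hh1
  have hlogyz : 0 < Real.log (y / z) := by linarith only [hlog1h, hh0]
  -- the short interval
  have hshort : ∑ n ∈ Finset.Ioc ⌊z⌋₊ ⌊y⌋₊, vonMangoldtNorm K n ≤ (V * h * z + V + 8 * C₂ * z ^ (2 / 3 : ℝ)) * (2 * L) :=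
    sum_Ioc_vonMangoldtNorm_le_of_count hV hC₂ hcount hz1 hzy.le hy2 hh0.le hy hlogy
  -- `ψ_ν(z)` bound
  have hψ : ‖∑ n ∈ Finset.Ioc 0 ⌊z⌋₊, twistVonMangoldt K ν n‖ ≤
      27 / 2 * K₁ * L ^ 2 * z * (E / h) + (V * h * z + V + 8 * C₂ * z ^ (2 / 3 : ℝ)) * (2 * L) := by
    refine hremove.trans (add_le_add ?_ hshort)
    rw [div_le_iff₀ hlogyz]
    calc _ ≤ 9 * K₁ * L ^ 2 * z * E := hRsum
      _ = 27 / 2 * K₁ * L ^ 2 * z * (E / h) * (2 * h / 3) := by field_simp; ring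
      _ ≤ 27 / 2 * K₁ * L ^ 2 * z * (E / h) * Real.log (y / z) :=
          mul_le_mul_of_nonneg_left hlog1h (mul_nonneg (mul_nonneg (mul_nonneg (mul_nonneg (by norm_num) hK₁0)
            (sq_nonneg L)) hz0.le) (div_nonneg hE0.le hh0.le))
  -- `ψ_ν(z) − θ_ν(z)` bound
  have hψθ : ‖∑ n ∈ Finset.Ioc 0 ⌊z⌋₊, twistVonMangoldt K ν n - grossenTheta ν z‖ ≤ 9 * Real.sqrt z * L ^ 2 := by
    have := norm_psi_sub_grossenTheta_le ν hν1 hz; rwa [← hL] at this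
  -- absorb `√z`, `z^{2/3}`, `1` into `W = z e^{−(c/12)√L}`
  obtain ⟨W, hW⟩ : ∃ W : ℝ, W = z * Real.exp (-(c / 12 * Real.sqrt L)) := ⟨_, rfl⟩
  obtain ⟨hsqrt_le, h23_le, hone_le⟩ := weight_dominates hz1 hL hL1 hcs
  rw [← hW] at hsqrt_le h23_le hone_le
  have hW0 : 0 < W := by linarith only [hone_le]
  have hhz : h * z = W := by rw [hW, hh]; ring
  have hQ2 : 1 ≤ (Real.log Q + 2) ^ 3 / δ := by
    rw [le_div_iff₀ hδ, one_mul]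
    have : 1 ≤ Real.log Q + 2 := by linarith only [hlogQ]
    linarith only [hδ18, one_le_pow₀ (n := 3) this]
  have hθ : ‖grossenTheta ν z‖ ≤ 27 / 2 * K₁ * L ^ 2 * W + (V * W + V + 8 * C₂ * W) * (2 * L) + 9 * W * L ^ 2 := by
    have htri : ‖grossenTheta ν z‖ ≤ ‖∑ n ∈ Finset.Ioc 0 ⌊z⌋₊, twistVonMangoldt K ν n‖ +
        ‖∑ n ∈ Finset.Ioc 0 ⌊z⌋₊, twistVonMangoldt K ν n - grossenTheta ν z‖ := by
      have := norm_sub_le (∑ n ∈ Finset.Ioc 0 ⌊z⌋₊, twistVonMangoldt K ν n)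
        (∑ n ∈ Finset.Ioc 0 ⌊z⌋₊, twistVonMangoldt K ν n - grossenTheta ν z)
      rwa [sub_sub_cancel] at this
    have hA : 27 / 2 * K₁ * L ^ 2 * z * (E / h) + (V * h * z + V + 8 * C₂ * z ^ (2 / 3 : ℝ)) * (2 * L) ≤
        27 / 2 * K₁ * L ^ 2 * W + (V * W + V + 8 * C₂ * W) * (2 * L) := by
      have e1 : 27 / 2 * K₁ * L ^ 2 * z * (E / h) = 27 / 2 * K₁ * L ^ 2 * W := by rw [hEh, hW]; ring
      have e2 : V * h * z = V * W := by rw [← hhz]; ring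
      rw [e1, e2]
      have e3 : 8 * C₂ * z ^ (2 / 3 : ℝ) ≤ 8 * C₂ * W := mul_le_mul_of_nonneg_left h23_le (by positivity)
      have e4 : (V * W + V + 8 * C₂ * z ^ (2 / 3 : ℝ)) * (2 * L) ≤ (V * W + V + 8 * C₂ * W) * (2 * L) :=
        mul_le_mul_of_nonneg_right (by linarith only [e3]) (by linarith only [hL1])
      linarith only [e4]
    have hB : 9 * Real.sqrt z * L ^ 2 ≤ 9 * W * L ^ 2 := by
      have h9 : Real.sqrt z * L ^ 2 ≤ W * L ^ 2 := mul_le_mul_of_nonneg_right hsqrt_le (sq_nonneg L)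
      linarith only [h9]
    linarith only [htri, hψ.trans hA, hψθ.trans hB]
  refine hθ.trans ?_
  have hW' : W = z * Real.exp (-(c / 12 * Real.sqrt (Real.log z))) := by rw [hW, hL]
  have hfin := core_algebra (P := (Real.log Q + 2) ^ 3 / δ) hC_T hV hC₂ hQ2 hL1 hone_le
  rw [hK₁]
  refine hfin.trans (le_of_eq ?_)
  rw [hW', hL]; ring

end Core

section Final

variable {q : ℕ}

/-- **Powers of `L` are dominated by `exp(κ√L)`**: `L^m ≤ ((2m)!/κ^{2m}) · exp(κ√L)` (`L ≥ 0`, `κ > 0`).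
[folklore] -/
theorem pow_le_mul_exp_sqrt (m : ℕ) {κ : ℝ} (hκ : 0 < κ) :
    ∃ Cm : ℝ, 0 < Cm ∧ ∀ L : ℝ, 0 ≤ L → L ^ m ≤ Cm * Real.exp (κ * Real.sqrt L) := by
  refine ⟨(2 * m).factorial / κ ^ (2 * m), by positivity, fun L hL ↦ ?_⟩
  have h := Real.pow_div_factorial_le_exp (x := κ * Real.sqrt L) (by positivity) (2 * m)
  have hk : (κ * Real.sqrt L) ^ (2 * m) = κ ^ (2 * m) * L ^ m := by
    rw [mul_pow]; congr 1; rw [pow_mul, Real.sq_sqrt hL]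
  rw [hk, div_le_iff₀ (by positivity)] at h
  have hκ2 : 0 < κ ^ (2 * m) := by positivity
  rw [div_mul_eq_mul_div, le_div_iff₀ hκ2]
  linarith only [h, mul_comm (L ^ m) (κ ^ (2 * m))]

/-- `log L ≤ 4 L^{1/4}` for `L ≥ 0`. [folklore] -/
theorem log_le_four_mul_rpow_quarter {L : ℝ} (hL : 0 ≤ L) : Real.log L ≤ 4 * L ^ ((1 : ℝ) / 4) := by
  have := Real.log_le_rpow_div hL (by norm_num : (0 : ℝ) < 1 / 4)
  linarith only [this, show L ^ ((1 : ℝ) / 4) / (1 / 4) = 4 * L ^ ((1 : ℝ) / 4) by ring]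

/-- **Eventual domination**: for `α, β, γ ≥ 0` there is `L₀ ≥ 1` with
`α + β log L + γ L^{1/4} ≤ √L/2` for all `L ≥ L₀`. [folklore] -/
theorem exists_large_of_le_sqrt {α β γ : ℝ} (hα : 0 ≤ α) (hβ : 0 ≤ β) (hγ : 0 ≤ γ) :
    ∃ L₀ : ℝ, 1 ≤ L₀ ∧ ∀ L : ℝ, L₀ ≤ L → α + β * Real.log L + γ * L ^ ((1 : ℝ) / 4) ≤ Real.sqrt L / 2 := by
  set u₀ : ℝ := 2 * (4 * β + γ) + α + 1 with hu₀
  have hu₀1 : 1 ≤ u₀ := by rw [hu₀]; nlinarith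
  refine ⟨u₀ ^ 4, one_le_pow₀ hu₀1, fun L hL ↦ ?_⟩
  have hL1 : 1 ≤ L := le_trans (one_le_pow₀ hu₀1) hL
  have hL0 : 0 ≤ L := by linarith
  set u : ℝ := L ^ ((1 : ℝ) / 4) with hu
  have hu0 : 0 ≤ u := Real.rpow_nonneg hL0 _
  have huu : u₀ ≤ u := by
    have h1 : (u₀ ^ 4) ^ ((1 : ℝ) / 4) = u₀ := by
      rw [← Real.rpow_natCast, ← Real.rpow_mul (by linarith)]; norm_num
    rw [hu, ← h1]
    exact Real.rpow_le_rpow (by positivity) hL (by norm_num)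
  have hsq : Real.sqrt L = u ^ 2 := by
    rw [hu, ← Real.rpow_natCast, ← Real.rpow_mul hL0, Real.sqrt_eq_rpow]; norm_num
  have hlog : Real.log L ≤ 4 * u := log_le_four_mul_rpow_quarter hL0
  have h1 : α + β * Real.log L + γ * u ≤ α + (4 * β + γ) * u := by nlinarith
  rw [hsq]
  have h2 : α + (4 * β + γ) * u ≤ u ^ 2 / 2 := by
    have hu1 : α + 1 ≤ u := by linarith
    nlinarith [mul_le_mul_of_nonneg_right huu hu0, sq_nonneg (α - 1)]
  linarith only [h1, h2]

/-- **The conductor in Heath-Brown's range**: for `1 ≤ q ≤ (log z)^A` and `|j|, |k| ≤ exp(c√(log z))`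
(`c ≥ 0`, `log z ≥ 1`), `log Q ≤ 6 + 3A log log z + 2c√(log z)` (`Q = condQZ q j k`). [folklore] -/
theorem log_condQZ_le {q : ℕ} (hq : 1 ≤ q) {A c L : ℝ} (hc : 0 ≤ c) (hL : 1 ≤ L)
    (hqA : (q : ℝ) ≤ L ^ A) {j k : ℤ} (hj : |(j : ℝ)| ≤ Real.exp (c * Real.sqrt L))
    (hk : |(k : ℝ)| ≤ Real.exp (c * Real.sqrt L)) :
    Real.log (condQZ q j k) ≤ 6 + 3 * A * Real.log L + 2 * c * Real.sqrt L := by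
  have hq0 : (0 : ℝ) < q := by exact_mod_cast hq
  have hq1 : (1 : ℝ) ≤ q := by exact_mod_cast hq
  have hL0 : 0 < L := by linarith
  set e := Real.exp (c * Real.sqrt L) with he
  have he1 : 1 ≤ e := by rw [he]; exact Real.one_le_exp (by positivity)
  have hS : |(j : ℝ)| + |(k : ℝ)| + 2 ≤ 4 * e := by linarith
  have hS0 : 0 < |(j : ℝ)| + |(k : ℝ)| + 2 := by positivity
  rw [condQZ, condQ]
  have hlog16 : Real.log 16 < 3 := by
    have h2 := Real.log_two_lt_d9
    have : Real.log 16 = 4 * Real.log 2 := by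
      rw [show (16 : ℝ) = 2 ^ 4 by norm_num, Real.log_pow]; norm_num
    rw [this]; linarith
  have hlog4 : Real.log 4 < 3 / 2 := by
    have h2 := Real.log_two_lt_d9
    have : Real.log 4 = 2 * Real.log 2 := by
      rw [show (4 : ℝ) = 2 ^ 2 by norm_num, Real.log_pow]; norm_num
    rw [this]; linarith
  have h1 : Real.log ((q : ℝ) ^ 3) ≤ 3 * A * Real.log L := by
    rw [Real.log_pow]
    have : Real.log q ≤ A * Real.log L := by
      calc Real.log q ≤ Real.log (L ^ A) := Real.log_le_log hq0 hqA
        _ = A * Real.log L := Real.log_rpow hL0 A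
    push_cast; linarith
  have h2 : Real.log ((|(j : ℝ)| + |(k : ℝ)| + 2) ^ 2) ≤ 2 * (Real.log 4 + c * Real.sqrt L) := by
    rw [Real.log_pow]
    have : Real.log (|(j : ℝ)| + |(k : ℝ)| + 2) ≤ Real.log 4 + c * Real.sqrt L := by
      calc Real.log (|(j : ℝ)| + |(k : ℝ)| + 2) ≤ Real.log (4 * e) := Real.log_le_log hS0 hS
        _ = Real.log 4 + c * Real.sqrt L := by rw [Real.log_mul (by norm_num) (by positivity), he, Real.log_exp]
    push_cast; linarith
  have hq3 : ((q : ℝ) ^ 3) ≠ 0 := pow_ne_zero 3 hq0.ne'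
  have hS2 : (|(j : ℝ)| + |(k : ℝ)| + 2) ^ 2 ≠ 0 := pow_ne_zero 2 hS0.ne'
  rw [Real.log_mul (by norm_num) (mul_ne_zero hq3 hS2), Real.log_mul hq3 hS2]
  linarith

/-- `q^ε ≤ L^{1/4}` when `1 ≤ q ≤ L^A`, `ε = 1/(4A)`, `A > 0`. [folklore] -/
theorem rpow_eps_le {q : ℕ} {A L : ℝ} (hA : 0 < A) (hL : 1 ≤ L) (hqA : (q : ℝ) ≤ L ^ A) :
    (q : ℝ) ^ (1 / (4 * A)) ≤ L ^ ((1 : ℝ) / 4) := by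
  have hq0 : (0 : ℝ) ≤ q := Nat.cast_nonneg _
  calc (q : ℝ) ^ (1 / (4 * A)) ≤ (L ^ A) ^ (1 / (4 * A)) := Real.rpow_le_rpow hq0 hqA (by positivity)
    _ = L ^ ((1 : ℝ) / 4) := by
        rw [← Real.rpow_mul (by linarith)]; congr 1; field_simp

/-- **Lemma 9.4 from the core estimate and a Siegel-type bound for the real zeros.** Given, for every
`ε > 0`, a constant `C(ε) > 0` with `C(ε) q^{−ε} ≤ 1 − β` for every real zero `β ∈ (17/18, 1]` of
`L(s, χ)`, `χ` a real non-principal character of `(𝓞_K/(q))^×` with `χ(ε₀) = 1` (Siegel's theorem with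
`L(1, χ) ≠ 0`; `SiegelTheoremAbstract`/`SiegelRealZerosAbstract`), Heath-Brown's Lemma 9.4 holds for every
`A > 0`: `∃ c > 0, C, z₀` with `‖θ_ν(z)‖ ≤ C z exp(−c√(log z))` for `z ≥ z₀`, `1 ≤ q ≤ (log z)^A`,
`|j|, |k| ≤ exp(c√(log z))`, `ν^{(j,k)}` non-trivial `mod q`.
[cite: HeathBrownActa2001, Lemma 9.4; Mitsui1956, Lemma 5; MontgomeryVaughan2007, §11.3 Theorem 11.16] -/
theorem grossenCharPNT_of_realZero_bound
    (hS : ∀ ε : ℝ, 0 < ε → ∃ Cε : ℝ, 0 < Cε ∧ ∀ (q : ℕ) (hq : 1 ≤ q) (χ : MulChar (QuotMod q) ℂ),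
      χ ^ 2 = 1 → χ ≠ 1 → charAngle χ = 0 → ∀ β : ℝ, 17 / 18 < β → β ≤ 1 →
        grossenL hq χ 0 0 β = 0 → Cε * (q : ℝ) ^ (-ε) ≤ 1 - β)
    (A : ℝ) (hA : 0 < A) :
    ∃ c : ℝ, 0 < c ∧ ∃ C z₀ : ℝ, GrossenCharPNT A c C z₀ := by
  obtain ⟨c₁, hc₁, C₁, hC₁, hcore⟩ := exists_norm_grossenTheta_le_core
  obtain ⟨c₀, hc₀, hzf⟩ := exists_zeroFree_grossenL
  obtain ⟨Cε, hCε, hSε⟩ := hS (1 / (4 * A)) (by positivity)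
  obtain ⟨C₅, hC₅, h5⟩ := pow_le_mul_exp_sqrt 5 (κ := c₁ / 24) (by positivity)
  obtain ⟨c, hc⟩ : ∃ c : ℝ, c = min (c₁ / 24) (min (1 / 4) (c₀ / (8 * c₁))) := ⟨_, rfl⟩
  have hc0 : 0 < c := by rw [hc]; exact lt_min (by positivity) (lt_min (by norm_num) (by positivity))
  have hc24 : c ≤ c₁ / 24 := by rw [hc]; exact min_le_left _ _
  have hc4 : c ≤ 1 / 4 := by rw [hc]; exact (min_le_right _ _).trans (min_le_left _ _)
  have hc8 : c ≤ c₀ / (8 * c₁) := by rw [hc]; exact (min_le_right _ _).trans (min_le_right _ _)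
  -- largeness
  obtain ⟨L₂, hL₂1, hL₂⟩ := exists_large_of_le_sqrt (α := 6) (β := 3 * A) (γ := 0) (by norm_num) (by positivity) le_rfl
  obtain ⟨L₃, hL₃1, hL₃⟩ := exists_large_of_le_sqrt (α := 36 * c₁ + 16 * c₁ / c₀) (β := 6 * A * c₁ / c₀)
    (γ := 2 * c₁ / Cε) (by positivity) (by positivity) (by positivity)
  obtain ⟨L₀, hL₀⟩ : ∃ L₀ : ℝ, L₀ = max 16 (max L₂ L₃) := ⟨_, rfl⟩
  refine ⟨c, hc0, C₁ * (27 / (2 * c₁)) * C₅, Real.exp L₀, fun z hz q hq hqA χ j k hj hk hν ↦ ?_⟩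
  -- `L = log z`
  have hz0 : 0 < z := (Real.exp_pos _).trans_le hz
  obtain ⟨L, hL⟩ : ∃ L : ℝ, L = Real.log z := ⟨_, rfl⟩
  have hLL₀ : L₀ ≤ L := by rw [hL, Real.le_log_iff_exp_le hz0]; exact hz
  have hL16 : 16 ≤ L := le_trans (by rw [hL₀]; exact le_max_left _ _) hLL₀
  have hLL₂ : L₂ ≤ L := le_trans (by rw [hL₀]; exact (le_max_left _ _).trans (le_max_right _ _)) hLL₀
  have hLL₃ : L₃ ≤ L := le_trans (by rw [hL₀]; exact (le_max_right _ _).trans (le_max_right _ _)) hLL₀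
  have hL1 : 1 ≤ L := by linarith
  have hL0 : 0 < L := by linarith
  have hz4 : Real.exp 4 ≤ z := by
    rw [← Real.exp_log hz0, Real.exp_le_exp, ← hL]; linarith
  have hsqL4 : 4 ≤ Real.sqrt L := by
    rw [show (4 : ℝ) = Real.sqrt 16 by rw [show (16 : ℝ) = 4 ^ 2 by norm_num, Real.sqrt_sq (by norm_num)]]
    exact Real.sqrt_le_sqrt hL16
  have hsqL1 : 1 ≤ Real.sqrt L := by linarith
  have hsqLL : Real.sqrt L * Real.sqrt L = L := Real.mul_self_sqrt hL0.le
  rw [← hL] at hqA hj hk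
  -- the conductor
  set ν := grossenChar hq χ j k with hνdef
  obtain ⟨Q, hQ⟩ : ∃ Q : ℝ, Q = condQZ q j k := ⟨_, rfl⟩
  have hQ1 : 1 ≤ Q := by rw [hQ]; exact one_le_condQZ hq j k
  have hlogQ0 : 0 ≤ Real.log Q := Real.log_nonneg hQ1
  have hlogQ : Real.log Q ≤ 6 + 3 * A * Real.log L + 2 * c * Real.sqrt L := by
    rw [hQ]; exact log_condQZ_le hq hc0.le hL1 hqA hj hk
  have hlogQL : Real.log Q ≤ Real.sqrt L := by
    have h1 := hL₂ L hLL₂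
    simp only [zero_mul, add_zero] at h1
    nlinarith only [hlogQ, h1, hc4, Real.sqrt_nonneg L]
  have hlog4 : Real.log 4 ≤ 2 := by
    have h2 := Real.log_two_lt_d9
    have : Real.log 4 = 2 * Real.log 2 := by
      rw [show (4 : ℝ) = 2 ^ 2 by norm_num, Real.log_pow]; norm_num
    rw [this]; linarith
  have hlog4pos : 0 < Real.log 4 := Real.log_pos (by norm_num)
  -- the no-real-zero parameter `δ`
  obtain ⟨δ, hδ0, hδ18, hnz, hδinv⟩ : ∃ δ : ℝ, 0 < δ ∧ δ ≤ 1 / 18 ∧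
      (∀ β : ℝ, 1 - δ < β → grossenL hq χ j k β ≠ 0) ∧
      1 / δ ≤ 18 + (Real.log Q + 2) / c₀ + L ^ ((1 : ℝ) / 4) / Cε := by
    by_cases hsq : IsTrivialMod q (sqChar ν)
    · -- real quadratic character: Siegel
      obtain ⟨hχ2, hj0, hk0, ht⟩ := params_of_isTrivialMod_sq hq hsq
      subst hj0; subst hk0
      have hχ1 : χ ≠ 1 := by
        rintro rfl; exact hν ((isTrivialMod_iff hq).2 ⟨rfl, rfl, rfl⟩)
      have hq0 : (0 : ℝ) < q := by exact_mod_cast hq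
      set η : ℝ := Cε * (q : ℝ) ^ (-(1 / (4 * A))) with hη
      have hη0 : 0 < η := by positivity
      refine ⟨min (1 / 18) η, lt_min (by norm_num) hη0, min_le_left _ _, ?_, ?_⟩
      · intro β hβ hLβ
        by_cases hβ1 : 1 < β
        · exact grossenL_ne_zero hq χ 0 0 hν (s := (β : ℂ)) (by simpa using hβ1) hLβ
        · rw [not_lt] at hβ1
          have h17 : 17 / 18 < β := by
            have := min_le_left (1 / 18 : ℝ) η; linarith
          have hS' := hSε q hq χ hχ2 hχ1 ht β h17 hβ1 hLβ
          have := min_le_right (1 / 18 : ℝ) η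
          linarith
      · -- `1/δ ≤ max(18, 1/η) ≤ 18 + q^ε/Cε ≤ 18 + L^{1/4}/Cε`
        have hinv : 1 / min (1 / 18) η ≤ 18 + 1 / η := by
          rcases min_choice (1 / 18 : ℝ) η with h | h <;> rw [h]
          · have : 0 ≤ 1 / η := by positivity
            norm_num; linarith
          · have : (0 : ℝ) ≤ 18 := by norm_num
            linarith
        have hη' : 1 / η = (q : ℝ) ^ (1 / (4 * A)) / Cε := by
          rw [hη, Real.rpow_neg hq0.le]; field_simp
        have hqε : (q : ℝ) ^ (1 / (4 * A)) / Cε ≤ L ^ ((1 : ℝ) / 4) / Cε :=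
          div_le_div_of_nonneg_right (rpow_eps_le hA hL1 hqA) hCε.le
        have : 0 ≤ (Real.log Q + 2) / c₀ := by positivity
        linarith
    · -- no real zeros near `1` at all (zero-free region)
      set η : ℝ := c₀ / (Real.log Q + Real.log 4) with hη
      have hη0 : 0 < η := by positivity
      refine ⟨min (1 / 18) η, lt_min (by norm_num) hη0, min_le_left _ _, ?_, ?_⟩
      · intro β hβ hLβ
        have hre : 1 - c₀ / (Real.log (condQZ q j k) + Real.log (|((β : ℂ)).im| + 4)) < ((β : ℂ)).re := by
          simp only [Complex.ofReal_im, abs_zero, zero_add, Complex.ofReal_re, ← hQ]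
          have := min_le_right (1 / 18 : ℝ) η
          linarith
        exact hsq (hzf q hq χ j k hν β hLβ hre).1
      · have hinv : 1 / min (1 / 18) η ≤ 18 + 1 / η := by
          rcases min_choice (1 / 18 : ℝ) η with h | h <;> rw [h]
          · have : 0 ≤ 1 / η := by positivity
            norm_num; linarith
          · have : (0 : ℝ) ≤ 18 := by norm_num
            linarith
        have hη' : 1 / η = (Real.log Q + Real.log 4) / c₀ := by rw [hη]; field_simp
        have h1 : (Real.log Q + Real.log 4) / c₀ ≤ (Real.log Q + 2) / c₀ :=
          div_le_div_of_nonneg_right (by linarith) hc₀.le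
        have : 0 ≤ L ^ ((1 : ℝ) / 4) / Cε := by positivity
        linarith
  -- `2c₁/δ ≤ √L`
  have hcδ : 2 * c₁ / δ ≤ Real.sqrt L := by
    have h3 := hL₃ L hLL₃
    have e1 : 2 * c₁ / δ = 2 * c₁ * (1 / δ) := by ring
    rw [e1]
    have e2 : 2 * c₁ * (1 / δ) ≤ 2 * c₁ * (18 + (Real.log Q + 2) / c₀ + L ^ ((1 : ℝ) / 4) / Cε) :=
      mul_le_mul_of_nonneg_left hδinv (by positivity)
    have e3 : 2 * c₁ * ((Real.log Q + 2) / c₀) ≤ 2 * c₁ * ((8 + 3 * A * Real.log L + 2 * c * Real.sqrt L) / c₀) :=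
      mul_le_mul_of_nonneg_left (div_le_div_of_nonneg_right (by linarith) hc₀.le) (by positivity)
    have e4 : 2 * c₁ * (2 * c * Real.sqrt L) / c₀ ≤ Real.sqrt L / 2 := by
      rw [div_le_iff₀ hc₀]
      have : c * (8 * c₁) ≤ c₀ := by rwa [le_div_iff₀ (by positivity)] at hc8
      nlinarith only [this, Real.sqrt_nonneg L]
    have e5 : (36 * c₁ + 16 * c₁ / c₀) + (6 * A * c₁ / c₀) * Real.log L + (2 * c₁ / Cε) * L ^ ((1 : ℝ) / 4) ≤
        Real.sqrt L / 2 := h3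
    have e6 : 2 * c₁ * (18 + (8 + 3 * A * Real.log L + 2 * c * Real.sqrt L) / c₀ + L ^ ((1 : ℝ) / 4) / Cε) =
        (36 * c₁ + 16 * c₁ / c₀) + (6 * A * c₁ / c₀) * Real.log L + (2 * c₁ / Cε) * L ^ ((1 : ℝ) / 4) +
          2 * c₁ * (2 * c * Real.sqrt L) / c₀ := by
      field_simp; ring
    nlinarith only [e2, e3, e4, e5, e6]
  have hmax : max (Real.log (condQZ q j k)) (2 * c₁ / δ) ≤ Real.sqrt (Real.log z) := by
    rw [← hQ, ← hL]; exact max_le hlogQL hcδ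
  -- the core estimate
  have hθ := hcore q hq χ j k hν δ hδ0 hδ18 hnz z hz4 hmax
  rw [← hQ, ← hL] at hθ
  refine hθ.trans ?_
  -- `(log Q + 2)³/δ · L³ ≤ (27/(2c₁)) L⁵ ≤ (27/(2c₁)) C₅ e^{(c₁/24)√L}`
  have hP : (Real.log Q + 2) ^ 3 / δ * L ^ 3 ≤ 27 / (2 * c₁) * L ^ 5 := by
    have h1 : (Real.log Q + 2) ^ 3 ≤ (3 * Real.sqrt L) ^ 3 :=
      pow_le_pow_left₀ (by linarith) (by linarith) 3
    have h2 : 1 / δ ≤ Real.sqrt L / (2 * c₁) := by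
      rw [div_le_div_iff₀ hδ0 (by positivity)]
      have := (div_le_iff₀ hδ0).1 hcδ
      linarith only [this]
    have h3 : (Real.log Q + 2) ^ 3 / δ ≤ (3 * Real.sqrt L) ^ 3 * (Real.sqrt L / (2 * c₁)) := by
      rw [div_eq_mul_one_div]
      exact mul_le_mul h1 h2 (by positivity) (by positivity)
    have h4 : (3 * Real.sqrt L) ^ 3 * (Real.sqrt L / (2 * c₁)) * L ^ 3 = 27 / (2 * c₁) * L ^ 5 := by
      have : Real.sqrt L ^ 4 = L ^ 2 := by
        rw [show (4 : ℕ) = 2 * 2 by norm_num, pow_mul, Real.sq_sqrt hL0.le]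
      field_simp
      nlinarith only [this, hsqLL]
    calc (Real.log Q + 2) ^ 3 / δ * L ^ 3 ≤ (3 * Real.sqrt L) ^ 3 * (Real.sqrt L / (2 * c₁)) * L ^ 3 :=
          mul_le_mul_of_nonneg_right h3 (by positivity)
      _ = 27 / (2 * c₁) * L ^ 5 := h4
  have hL5 := h5 L hL0.le
  have hexp : Real.exp (c₁ / 24 * Real.sqrt L) * Real.exp (-(c₁ / 12 * Real.sqrt L)) ≤
      Real.exp (-(c * Real.sqrt L)) := by
    rw [← Real.exp_add, Real.exp_le_exp]
    nlinarith only [hc24, Real.sqrt_nonneg L]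
  have hz0' : 0 ≤ z := hz0.le
  calc C₁ * ((Real.log Q + 2) ^ 3 / δ) * L ^ 3 * z * Real.exp (-(c₁ / 12 * Real.sqrt L))
      = C₁ * ((Real.log Q + 2) ^ 3 / δ * L ^ 3) * (z * Real.exp (-(c₁ / 12 * Real.sqrt L))) := by ring
    _ ≤ C₁ * (27 / (2 * c₁) * L ^ 5) * (z * Real.exp (-(c₁ / 12 * Real.sqrt L))) := by
        refine mul_le_mul_of_nonneg_right (mul_le_mul_of_nonneg_left hP hC₁) (by positivity)
    _ ≤ C₁ * (27 / (2 * c₁) * (C₅ * Real.exp (c₁ / 24 * Real.sqrt L))) * (z * Real.exp (-(c₁ / 12 * Real.sqrt L))) := by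
        refine mul_le_mul_of_nonneg_right (mul_le_mul_of_nonneg_left
          (mul_le_mul_of_nonneg_left hL5 (by positivity)) hC₁) (by positivity)
    _ = C₁ * (27 / (2 * c₁)) * C₅ * z * (Real.exp (c₁ / 24 * Real.sqrt L) * Real.exp (-(c₁ / 12 * Real.sqrt L))) := by
        ring
    _ ≤ C₁ * (27 / (2 * c₁)) * C₅ * z * Real.exp (-(c * Real.sqrt L)) :=
        mul_le_mul_of_nonneg_left hexp (by positivity)
    _ = _ := by rw [hL]

end Final

end Literature.NumberTheory.Sieve.CubicSieve
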